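import Literature.RingTheory.MvPowerSeries.MonoidPowerSeriesDivision
import Mathlib.RingTheory.IntegralClosure.IntegrallyClosed
import Mathlib.RingTheory.Localization.FractionRing
import HarnessLib

/-!
# Pure submonoids: `R⟦P⟧` is a direct summand of `R⟦x⟧`, and normality of `R⟦P⟧`, `R⟦P⟧/(θ)`

Topic: `Literature/RingTheory/MvPowerSeries` (continuation of `MonoidPowerSeries`,
`MonoidPowerSeriesDivision`). W. Bruns, J. Gubeladze, *Polytopes, Rings, and K-Theory* (Springer
2009), Thm. 4.38 (p. 128): for a positive affine monoid `M ⊆ ℤⁿ₊` with `M = gp(M) ∩ ℤⁿ₊` ("pure"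
embedding, Thm. 2.29) one has `M + N ⊆ N` for `N = ℤⁿ₊ ∖ M`, so the `R`-submodule spanned by the
monomials of `N` is an `R[M]`-module complement: `R[M]` is a direct summand of `R[X₁,…,X_n]` as an
`R[M]`-module, hence (Thm. 4.35) integrally closed when `R[X]` is. We prove the analogue for the
completed monoid algebra `R⟦P⟧ ⊆ R⟦x⟧ = MvPowerSeries σ R` of `MonoidPowerSeries.lean`
(K. Kato, *Toric singularities*, Amer. J. Math. 116 (1994), §3, where `R[[P]]` carries the complete
local rings of log regular schemes, Thm. (3.2), and Thm. (4.1) asserts their normality):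

* `monoidPowerSeries.exists_truncation` — for `P` PURE in `ℕ^{(σ)}`
  (`∀ a ∈ P, ∀ b, a + b ∈ P → b ∈ P`) the coefficient truncation `ρ : R⟦x⟧ → R⟦P⟧` is an additive
  retraction with `ρ (f g) = f ρ(g)` for `f ∈ R⟦P⟧`;
* `isIntegrallyClosed_of_injective_of_dvd` — a ring injecting into an integrally closed domain by a
  map reflecting divisibility is an integrally closed domain (the abstract form of "direct summands
  of normal domains are normal");
* `monoidPowerSeries.dvd_of_coe_dvd`, `monoidPowerSeries.isIntegrallyClosed_of_pure` — `R⟦P⟧` is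
  integrally closed when `R⟦x⟧` is an integrally closed domain and `P` is pure;
* `monoidPowerSeries.isIntegrallyClosed_quotient_of_pure` — for `θ ∈ R⟦P⟧` whose constant
  coefficient is a non-zero-divisor of `R` (Kato's Lemma (3.5): `θR⟦x⟧ ∩ R⟦P⟧ = θR⟦P⟧`), if
  `R⟦x⟧/(θ)` is an integrally closed domain then so is `R⟦P⟧/(θ)`.

References: [BrunsGubeladze2009] W. Bruns, J. Gubeladze, Polytopes, Rings, and K-Theory, Springer
Monographs in Mathematics (2009), Thm. 4.35 (p. 127), Thm. 4.38 (p. 128); [Kato1994] K. Kato, Toric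
singularities, Amer. J. Math. 116 (1994), Lemma (3.5), Thm. (4.1).
-/

noncomputable section

open Polynomial

namespace Literature.RingTheory.MvPowerSeries

universe u v w

/-! ### Split injections into normal domains -/

/-- **Direct summands of normal domains are normal** (abstract form): if `ι : C → B` is an
injective ring map into an integrally closed domain which REFLECTS DIVISIBILITY
(`ι b ∣ ι a → b ∣ a`, e.g. because `ι` has a `C`-linear retraction), then `C` is integrally closed.
Proof: an element `a/b` of `Frac C` integral over `C` maps to an element of `Frac B` integral over
`B`, which lies in `B`, so `ι b ∣ ι a`, so `b ∣ a`. [cite: BrunsGubeladze2009, Thm. 4.38 (p. 128)] -/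
theorem isIntegrallyClosed_of_injective_of_dvd {C : Type u} {B : Type v} [CommRing C] [CommRing B]
    [IsDomain B] [IsIntegrallyClosed B] (ι : C →+* B) (hι : Function.Injective ι)
    (hdvd : ∀ a b : C, ι b ∣ ι a → b ∣ a) : IsIntegrallyClosed C := by
  haveI : IsDomain C := hι.isDomain ι
  let K := FractionRing C
  let L := FractionRing B
  have hle : nonZeroDivisors C ≤ (nonZeroDivisors B).comap ι :=
    nonZeroDivisors_le_comap_nonZeroDivisors_of_injective ι hι
  let j : K →+* L := IsLocalization.map L ι hle
  have hj : ∀ c : C, j (algebraMap C K c) = algebraMap B L (ι c) := fun c =>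
    IsLocalization.map_eq hle c
  rw [isIntegrallyClosed_iff K]
  intro x hx
  -- `j x` is integral over `B`
  obtain ⟨p, hp, hpx⟩ := hx
  have hjx : IsIntegral B (j x) := by
    refine ⟨p.map ι, hp.map ι, ?_⟩
    have h := congrArg j hpx
    rw [map_zero, Polynomial.hom_eval₂] at h
    have hcomp : j.comp (algebraMap C K) = (algebraMap B L).comp ι := RingHom.ext hj
    rw [hcomp, ← Polynomial.eval₂_map] at h
    exact h
  obtain ⟨y, hy⟩ := (IsIntegrallyClosed.isIntegral_iff (R := B) (K := L)).1 hjx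
  -- write `x = a / b`
  obtain ⟨a, b, hb, rfl⟩ := IsFractionRing.div_surjective (A := C) x
  have hb0 : algebraMap B L (ι b) ≠ 0 := by
    intro h
    have : ι b = 0 := (IsFractionRing.injective B L) (by rw [h, map_zero])
    exact nonZeroDivisors.ne_zero hb (hι (by rw [this, map_zero]))
  have hab : ι a = y * ι b := by
    apply IsFractionRing.injective B L
    rw [map_mul, hy, map_div₀, hj, hj, div_mul_cancel₀ _ hb0]
  obtain ⟨c, hc⟩ := hdvd a b ⟨y, by rw [hab, mul_comm]⟩
  refine ⟨c, ?_⟩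
  have hbK : algebraMap C K b ≠ 0 := fun h =>
    nonZeroDivisors.ne_zero hb ((IsFractionRing.injective C K) (by rw [h, map_zero]))
  rw [eq_div_iff hbK, ← map_mul, mul_comm, ← hc]

namespace monoidPowerSeries

variable {σ : Type u} {R : Type v} [CommRing R] {P : AddSubmonoid (σ →₀ ℕ)}

/-! ### The truncation retraction for a pure submonoid -/

/-- **`R⟦P⟧` is a direct summand of `R⟦x⟧` for `P` pure.** If `P ⊆ ℕ^{(σ)}` is PURE
(`a ∈ P`, `a + b ∈ P` ⇒ `b ∈ P`, i.e. `P = gp(P) ∩ ℕ^{(σ)}`), the truncation `ρ` keeping the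
coefficients with exponent in `P` is an additive retraction `R⟦x⟧ → R⟦P⟧` which is `R⟦P⟧`-linear:
`ρ(f g) = f ρ(g)` for `f ∈ R⟦P⟧` (the monomials off `P` span an `R⟦P⟧`-submodule, as
`P + (ℕ^{(σ)} ∖ P) ⊆ ℕ^{(σ)} ∖ P`). [cite: BrunsGubeladze2009, Thm. 4.38 (p. 128)] -/
theorem exists_truncation (hpure : ∀ a ∈ P, ∀ b : σ →₀ ℕ, a + b ∈ P → b ∈ P) :
    ∃ ρ : MvPowerSeries σ R →+ MvPowerSeries σ R,
      (∀ g, ρ g ∈ monoidPowerSeries R P) ∧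
      (∀ g (e : σ →₀ ℕ), e ∈ P → MvPowerSeries.coeff e (ρ g) = MvPowerSeries.coeff e g) ∧
      (∀ f ∈ monoidPowerSeries R P, ρ f = f) ∧
      (∀ f ∈ monoidPowerSeries R P, ∀ g, ρ (f * g) = f * ρ g) := by
  classical
  let ρ₀ : MvPowerSeries σ R → MvPowerSeries σ R := fun g e =>
    if e ∈ P then MvPowerSeries.coeff e g else 0
  have hcoeff : ∀ g e, MvPowerSeries.coeff e (ρ₀ g) = if e ∈ P then MvPowerSeries.coeff e g else 0 :=
    fun g e => rfl
  let ρ : MvPowerSeries σ R →+ MvPowerSeries σ R :=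
    { toFun := ρ₀
      map_zero' := by
        ext e; rw [hcoeff, map_zero]; split_ifs <;> rfl
      map_add' := fun g h => by
        ext e; rw [map_add, hcoeff, hcoeff, hcoeff, map_add]; split_ifs <;> simp }
  have hρ : ∀ g e, MvPowerSeries.coeff e (ρ g) = if e ∈ P then MvPowerSeries.coeff e g else 0 :=
    hcoeff
  have hmem : ∀ g, ρ g ∈ monoidPowerSeries R P := by
    intro g e he
    rw [hρ, if_neg he]
  have hin : ∀ g (e : σ →₀ ℕ), e ∈ P → MvPowerSeries.coeff e (ρ g) = MvPowerSeries.coeff e g := by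
    intro g e he
    rw [hρ, if_pos he]
  have hid : ∀ f ∈ monoidPowerSeries R P, ρ f = f := by
    intro f hf
    ext e
    rw [hρ]
    split_ifs with he
    · rfl
    · exact (hf e he).symm
  refine ⟨ρ, hmem, hin, hid, fun f hf g => ?_⟩
  ext e
  by_cases he : e ∈ P
  · -- both sides are `∑_{a+b=e} f_a g_b` restricted to `a ∈ P`, and then `b ∈ P` by purity
    rw [hin _ e he, MvPowerSeries.coeff_mul, MvPowerSeries.coeff_mul]
    refine Finset.sum_congr rfl fun x hx => ?_
    rw [Finset.HasAntidiagonal.mem_antidiagonal] at hx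
    by_cases ha : x.1 ∈ P
    · rw [hin _ x.2 (hpure x.1 ha x.2 (hx ▸ he))]
    · rw [hf x.1 ha, zero_mul, zero_mul]
  · rw [(hmem (f * g)) e he, ((monoidPowerSeries R P).mul_mem hf (hmem g)) e he]

/-- Under purity, divisibility in `R⟦x⟧` between elements of `R⟦P⟧` descends to `R⟦P⟧`:
`a = b y` ⇒ `a = ρ(a) = b ρ(y)`. [cite: BrunsGubeladze2009, Thm. 4.38 (p. 128)] -/
theorem dvd_of_coe_dvd (hpure : ∀ a ∈ P, ∀ b : σ →₀ ℕ, a + b ∈ P → b ∈ P)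
    {a b : monoidPowerSeries R P} (h : (b : MvPowerSeries σ R) ∣ (a : MvPowerSeries σ R)) :
    b ∣ a := by
  obtain ⟨ρ, hmem, -, hid, hmul⟩ := exists_truncation (R := R) hpure
  obtain ⟨y, hy⟩ := h
  refine ⟨⟨ρ y, hmem y⟩, Subtype.ext ?_⟩
  show (a : MvPowerSeries σ R) = b * ρ y
  rw [← hmul _ b.2, ← hy, hid _ a.2]

/-- **`R⟦P⟧` is an integrally closed domain for `P` pure, when `R⟦x⟧` is** (e.g. `R` a field or a
discrete valuation ring, `σ` finite: then `R⟦x⟧` is a regular local ring). Completed form of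
Bruns–Gubeladze Thm. 4.35/4.38 (`R[M]` normal for `M` normal).
[cite: BrunsGubeladze2009, Thm. 4.38 (p. 128)] -/
theorem isIntegrallyClosed_of_pure [IsDomain (MvPowerSeries σ R)]
    [IsIntegrallyClosed (MvPowerSeries σ R)]
    (hpure : ∀ a ∈ P, ∀ b : σ →₀ ℕ, a + b ∈ P → b ∈ P) :
    IsDomain (monoidPowerSeries R P) ∧ IsIntegrallyClosed (monoidPowerSeries R P) := by
  have hinj : Function.Injective (monoidPowerSeries R P).val.toRingHom := Subtype.val_injective
  exact ⟨hinj.isDomain _, isIntegrallyClosed_of_injective_of_dvd _ hinj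
    fun a b h => dvd_of_coe_dvd hpure h⟩

/-- **`R⟦P⟧/(θ)` is an integrally closed domain for `P` pure**, when `θ ∈ R⟦P⟧` has constant
coefficient a non-zero-divisor of `R` and `R⟦x⟧/(θ)` is an integrally closed domain: the map
`R⟦P⟧/(θ) → R⟦x⟧/(θ)` is injective (Kato's Lemma (3.5), `quotientMap_injective`) and reflects
divisibility (`a = b y + θ z` ⇒ `a = b ρ(y) + θ ρ(z)`). This is the normality of the complete local
rings `R[[P]]/(θ)` of Kato's Thm. (3.2)(2), i.e. of Thm. (4.1), for pure `P`.
[cite: Kato1994, Lemma (3.5) and Thm. (4.1)] -/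
theorem isIntegrallyClosed_quotient_of_pure (hpure : ∀ a ∈ P, ∀ b : σ →₀ ℕ, a + b ∈ P → b ∈ P)
    (θ : monoidPowerSeries R P)
    (hπ : MvPowerSeries.constantCoeff (θ : MvPowerSeries σ R) ∈ nonZeroDivisors R)
    [IsDomain (MvPowerSeries σ R ⧸ Ideal.span {(θ : MvPowerSeries σ R)})]
    [IsIntegrallyClosed (MvPowerSeries σ R ⧸ Ideal.span {(θ : MvPowerSeries σ R)})] :
    IsDomain (monoidPowerSeries R P ⧸ Ideal.span {θ}) ∧
      IsIntegrallyClosed (monoidPowerSeries R P ⧸ Ideal.span {θ}) := by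
  have hle : Ideal.span {θ} ≤ (Ideal.span {(θ : MvPowerSeries σ R)}).comap
      (monoidPowerSeries R P).val.toRingHom := by
    rw [Ideal.span_le, Set.singleton_subset_iff]
    exact Ideal.mem_comap.2 (Ideal.subset_span rfl)
  have hinj := quotientMap_injective θ hπ hle
  refine ⟨hinj.isDomain _, isIntegrallyClosed_of_injective_of_dvd _ hinj fun a b h => ?_⟩
  obtain ⟨ρ, hmem, -, hid, hmul⟩ := exists_truncation (R := R) hpure
  obtain ⟨a, rfl⟩ := Ideal.Quotient.mk_surjective a
  obtain ⟨b, rfl⟩ := Ideal.Quotient.mk_surjective b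
  obtain ⟨y, hy⟩ := h
  obtain ⟨y, rfl⟩ := Ideal.Quotient.mk_surjective y
  rw [Ideal.quotientMap_mk, Ideal.quotientMap_mk, ← map_mul, Ideal.Quotient.eq,
    Ideal.mem_span_singleton] at hy
  obtain ⟨z, hz⟩ := hy
  -- `a = b y + θ z` in `R⟦x⟧`; truncate
  have hz' : (a : MvPowerSeries σ R) - b * y = θ * z := hz
  have ha : (a : MvPowerSeries σ R) = b * ρ y + θ * ρ z := by
    rw [← hmul _ b.2, ← hmul _ θ.2, ← map_add, ← hz', add_sub_cancel, hid _ a.2]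
  refine ⟨Ideal.Quotient.mk _ ⟨ρ y, hmem y⟩, ?_⟩
  rw [← map_mul, Ideal.Quotient.eq, Ideal.mem_span_singleton]
  refine ⟨⟨ρ z, hmem z⟩, Subtype.ext ?_⟩
  show (a : MvPowerSeries σ R) - b * ρ y = θ * ρ z
  rw [ha, add_sub_cancel_left]

end monoidPowerSeries

end Literature.RingTheory.MvPowerSeries

end
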